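import Mathlib
import Summits.Ventures.PercRepro2.Defs
import Summits.Ventures.PercRepro2.CoinKStarLattice
import Summits.Ventures.PercRepro2.CoinKStarTilt
import Summits.Ventures.PercRepro2.CoinKStarLaw
import Summits.Ventures.PercRepro2.CoinLsmHeadLaw
import Summits.Ventures.PercRepro2.CoinLsmHeadSteps
import Summits.Ventures.PercRepro2.CoinKStarCases

/-!
# The ABSTRACT k-STAR LEMMA (blind cell PercRepro2, night-2 g5; proofs/NIGHT2-DARC.md §26)

The avoidance-function form of row 2′DARC at a k-star head `P = {w} ∪ Vs`: `F S` stands for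
`P_{D₀}(s ↛ S ∪ {t})` (decreasing, log-supermodular — directed BHK), `β i` for the leaf
probability of `vᵢ → t`, `q i = 1 − αᵢ` for the probability that the arm `w → vᵢ` is closed.  On the
leaf lattice the trace law is `kA L = leafLaw L · armProd L` at the trace `L` (`w ∉ K⁻`) and
`kB L = leafLaw L · (1 − armProd L)` at `L ∪ {w}`.  The theorem `kStar_functional_nonneg` is the
statement `S′ ≥ 0` of §17.1 in this vocabulary: the cleared shift sum over the two kinds of traces
is nonnegative.  Proof: `S′ = M₁ + C₁ − C₂` (three FKG brackets with shifts), the comparisons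
(F1)–(F5) by `holley_powerset` / `tilt_prod`, and the three-case sign split `kStar_cases`.
-/

namespace Summit.Ventures.PercRepro2.Coin

section KStarAbstract

open Classical

variable {V : Type*} [Fintype V] [DecidableEq V] {R : Type*} [Field R] [LinearOrder R]
  [IsStrictOrderedRing R]

set_option maxHeartbeats 1000000 in
/-- **The abstract LSM-HEAD lemma** (`S′ ≥ 0`, NIGHT2-DARC.md §26–§27): for `F` nonnegative,
decreasing and log-supermodular (positive on the traces and on the gate cells), marker masses
`Ga, Gb ≥ 0` whose ratios `G S / F S` increase with `S` (cleared: `G S · F S' ≤ G S' · F S` for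
`S ⊆ S'`), a LOG-SUPERMODULAR nonnegative leaf-side trace law `β` on the subsets of `Vs`, arm
factors `q ∈ [0, 1]`, and `w, u ∉ Vs` with `w ≠ u`, the cleared shift sum of the two kinds of
traces is nonnegative.  (`Ga S = F (S ∪ {a})` for the point marker `a` — `insert_ratio_cleared`;
`Ga S = E[1 − F₁; R_{S ∪ {t}}]` for a cluster functional — `shiftF`; `β` = the product law of
independent leaves for the k-star, the trace law of a pendant forest in general.) -/
theorem lsmHead_functional_nonneg (Vs : Finset V) (w u : V) (hw : w ∉ Vs) (hu : u ∉ Vs)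
    (hwu : w ≠ u) (F Ga Gb : Finset V → R) (hF0 : ∀ S, 0 ≤ F S)
    (hFdec : ∀ S S', S ⊆ S' → F S' ≤ F S)
    (hFlsm : ∀ S S', F S * F S' ≤ F (S ∩ S') * F (S ∪ S'))
    (hFpos : ∀ L ⊆ Vs, 0 < F L) (hFposwu : ∀ L ⊆ Vs, 0 < F (insert u (insert w L)))
    (hGa0 : ∀ S, 0 ≤ Ga S) (hGb0 : ∀ S, 0 ≤ Gb S)
    (hGa : ∀ S S', S ⊆ S' → Ga S * F S' ≤ Ga S' * F S)
    (hGb : ∀ S S', S ⊆ S' → Gb S * F S' ≤ Gb S' * F S)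
    (β : Finset V → R) (hβ0 : ∀ L ⊆ Vs, 0 ≤ β L)
    (hβ : ∀ L L', L ⊆ Vs → L' ⊆ Vs → β L * β L' ≤ β (L ∩ L') * β (L ∪ L'))
    (q : V → R) (hq0 : ∀ i ∈ Vs, 0 ≤ q i) (hq1 : ∀ i ∈ Vs, q i ≤ 1) :
    0 ≤ (∑ L ∈ Vs.powerset, hA β q L * F L *
          (Ga L / F L * hLam Vs β q w F - hMass Vs β q w Ga) *
          (Gb L / F L * hLam Vs β q w F - hMass Vs β q w Gb)) +
        ∑ L ∈ Vs.powerset, hB β q L * F (insert u (insert w L)) *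
          (Ga (insert u (insert w L)) / F (insert u (insert w L)) * hLam Vs β q w F -
            hMass Vs β q w Ga) *
          (Gb (insert u (insert w L)) / F (insert u (insert w L)) * hLam Vs β q w F -
            hMass Vs β q w Gb) := by
  set Λ := hLam Vs β q w F with hΛ
  set Fa := hMass Vs β q w Ga with hFa
  set Fb := hMass Vs β q w Gb with hFb
  -- the weights and the data on the leaf lattice
  set μ₁ : Finset V → R := wA β q F with hμ₁
  set μ₂ : Finset V → R := wA' β q F w u with hμ₂
  set μω : Finset V → R := wΩ β F w u with hμω
  set μw : Finset V → R := wB β q F w with hμw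
  set x₁ : Finset V → R := fun L => Ga L / F L with hx₁
  set y₁ : Finset V → R := fun L => Gb L / F L with hy₁
  set x₂ : Finset V → R := fun L => Ga (insert u (insert w L)) / F (insert u (insert w L)) with hx₂
  set y₂ : Finset V → R := fun L => Gb (insert u (insert w L)) / F (insert u (insert w L)) with hy₂
  set xw : Finset V → R := fun L => Ga (insert w L) / F (insert w L) with hxw
  set yw : Finset V → R := fun L => Gb (insert w L) / F (insert w L) with hyw
  -- the three shift sums
  set Sh₁ := ∑ L ∈ Vs.powerset, μ₁ L * (x₁ L * Λ - Fa) * (y₁ L * Λ - Fb) with hSh₁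
  set Sh₂ := ∑ L ∈ Vs.powerset, μ₂ L * (x₂ L * Λ - Fa) * (y₂ L * Λ - Fb) with hSh₂
  set Shω := ∑ L ∈ Vs.powerset, μω L * (x₂ L * Λ - Fa) * (y₂ L * Λ - Fb) with hShω
  have hgoal : (∑ L ∈ Vs.powerset, hA β q L * F L * (Ga L / F L * Λ - Fa) *
        (Gb L / F L * Λ - Fb)) +
      ∑ L ∈ Vs.powerset, hB β q L * F (insert u (insert w L)) *
        (Ga (insert u (insert w L)) / F (insert u (insert w L)) * Λ - Fa) *
        (Gb (insert u (insert w L)) / F (insert u (insert w L)) * Λ - Fb) =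
      Sh₁ + (Shω - Sh₂) := by
    rw [hShω, hSh₂, ← Finset.sum_sub_distrib]
    congr 1
    refine Finset.sum_congr rfl fun L _ => ?_
    simp only [hμω, hμ₂, wΩ, wA', hx₂, hy₂, hB, hA]
    ring
  rw [hgoal]
  -- positivity and monotonicity facts
  have hsub_wu : ∀ L ⊆ Vs, insert w L ⊆ insert u (insert w L) :=
    fun L _ => Finset.subset_insert _ _
  have hFw : ∀ L ⊆ Vs, 0 < F (insert w L) := fun L hL =>
    lt_of_lt_of_le (hFposwu L hL) (hFdec _ _ (hsub_wu L hL))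
  have hwnotin : ∀ L ⊆ Vs, w ∉ L := fun L hL h => hw (hL h)
  have hunotin : ∀ L ⊆ Vs, u ∉ L := fun L hL h => hu (hL h)
  have hunotinw : ∀ L ⊆ Vs, u ∉ insert w L := fun L hL h => by
    rcases Finset.mem_insert.mp h with h | h
    · exact hwu h.symm
    · exact hu (hL h)
  -- the weights are nonnegative and log-supermodular
  have hμ₁0 : ∀ L ⊆ Vs, 0 ≤ μ₁ L := fun L hL => wA_nonneg hF0 hβ0 hq0 hL
  have hμ₂0 : ∀ L ⊆ Vs, 0 ≤ μ₂ L := fun L hL => wA'_nonneg hF0 hβ0 hq0 hL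
  have hμω0 : ∀ L ⊆ Vs, 0 ≤ μω L := fun L hL => wΩ_nonneg hF0 hβ0 hL
  have hμw0 : ∀ L ⊆ Vs, 0 ≤ μw L := fun L hL => wB_nonneg hF0 hβ0 hq0 hq1 hL
  have hμ₁lsm : ∀ L L', L ⊆ Vs → L' ⊆ Vs → μ₁ L * μ₁ L' ≤ μ₁ (L ∩ L') * μ₁ (L ∪ L') :=
    fun L L' hL hL' => wA_lsm hF0 hFlsm hβ0 hβ hq0 hL hL'
  have hμ₂lsm : ∀ L L', L ⊆ Vs → L' ⊆ Vs → μ₂ L * μ₂ L' ≤ μ₂ (L ∩ L') * μ₂ (L ∪ L') :=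
    fun L L' hL hL' => wA'_lsm hF0 hFlsm hβ0 hβ hq0 hL hL'
  have hμωlsm : ∀ L L', L ⊆ Vs → L' ⊆ Vs → μω L * μω L' ≤ μω (L ∩ L') * μω (L ∪ L') :=
    fun L L' hL hL' => wΩ_lsm hF0 hFlsm hβ0 hβ hL hL'
  -- the data are nonnegative and increasing, and ordered pointwise
  have hrat : ∀ G : Finset V → R, (∀ S S', S ⊆ S' → G S * F S' ≤ G S' * F S) →
      ∀ S S', S ⊆ S' → 0 < F S → 0 < F S' → G S / F S ≤ G S' / F S' :=
    fun G hG S S' h hS hS' => (div_le_div_iff₀ hS hS').mpr (hG S S' h)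
  have hx₁0 : ∀ L ⊆ Vs, 0 ≤ x₁ L := fun L _ => div_nonneg (hGa0 _) (hF0 _)
  have hy₁0 : ∀ L ⊆ Vs, 0 ≤ y₁ L := fun L _ => div_nonneg (hGb0 _) (hF0 _)
  have hx₂0 : ∀ L ⊆ Vs, 0 ≤ x₂ L := fun L _ => div_nonneg (hGa0 _) (hF0 _)
  have hy₂0 : ∀ L ⊆ Vs, 0 ≤ y₂ L := fun L _ => div_nonneg (hGb0 _) (hF0 _)
  have hx₁m : ∀ L L', L ⊆ L' → L' ⊆ Vs → x₁ L ≤ x₁ L' := fun L L' hLL' hL' =>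
    hrat Ga hGa L L' hLL' (hFpos L (hLL'.trans hL')) (hFpos L' hL')
  have hy₁m : ∀ L L', L ⊆ L' → L' ⊆ Vs → y₁ L ≤ y₁ L' := fun L L' hLL' hL' =>
    hrat Gb hGb L L' hLL' (hFpos L (hLL'.trans hL')) (hFpos L' hL')
  have hx₂m : ∀ L L', L ⊆ L' → L' ⊆ Vs → x₂ L ≤ x₂ L' := fun L L' hLL' hL' =>
    hrat Ga hGa _ _ (Finset.insert_subset_insert u (Finset.insert_subset_insert w hLL'))
      (hFposwu L (hLL'.trans hL')) (hFposwu L' hL')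
  have hy₂m : ∀ L L', L ⊆ L' → L' ⊆ Vs → y₂ L ≤ y₂ L' := fun L L' hLL' hL' =>
    hrat Gb hGb _ _ (Finset.insert_subset_insert u (Finset.insert_subset_insert w hLL'))
      (hFposwu L (hLL'.trans hL')) (hFposwu L' hL')
  have hx₁₂ : ∀ L ⊆ Vs, x₁ L ≤ x₂ L := fun L hL =>
    hrat Ga hGa _ _ ((Finset.subset_insert w L).trans (Finset.subset_insert u _))
      (hFpos L hL) (hFposwu L hL)
  have hy₁₂ : ∀ L ⊆ Vs, y₁ L ≤ y₂ L := fun L hL =>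
    hrat Gb hGb _ _ ((Finset.subset_insert w L).trans (Finset.subset_insert u _))
      (hFpos L hL) (hFposwu L hL)
  have hx₁w : ∀ L ⊆ Vs, x₁ L ≤ xw L := fun L hL =>
    hrat Ga hGa _ _ (Finset.subset_insert w L) (hFpos L hL) (hFw L hL)
  have hy₁w : ∀ L ⊆ Vs, y₁ L ≤ yw L := fun L hL =>
    hrat Gb hGb _ _ (Finset.subset_insert w L) (hFpos L hL) (hFw L hL)
  have hxw₂ : ∀ L ⊆ Vs, xw L ≤ x₂ L := fun L hL =>
    hrat Ga hGa _ _ (Finset.subset_insert u _) (hFw L hL) (hFposwu L hL)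
  have hyw₂ : ∀ L ⊆ Vs, yw L ≤ y₂ L := fun L hL =>
    hrat Gb hGb _ _ (Finset.subset_insert u _) (hFw L hL) (hFposwu L hL)
  -- masses and moments
  set W₁ := pw Vs μ₁ with hW₁
  set W₂ := pw Vs μ₂ with hW₂
  set Ω := pw Vs μω with hΩ
  set Ww := pw Vs μw with hWw
  set Mx₁ := pm Vs μ₁ x₁ with hMx₁
  set My₁ := pm Vs μ₁ y₁ with hMy₁
  set Mx₂ := pm Vs μ₂ x₂ with hMx₂
  set My₂ := pm Vs μ₂ y₂ with hMy₂
  set Mxω := pm Vs μω x₂ with hMxω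
  set Myω := pm Vs μω y₂ with hMyω
  set Mxw := pm Vs μw xw with hMxw
  set Myw := pm Vs μw yw with hMyw
  set K₁ := pk Vs μ₁ x₁ y₁ with hK₁
  set K₂ := pk Vs μ₂ x₂ y₂ with hK₂
  set Kω := pk Vs μω x₂ y₂ with hKω
  have hW₁0 : 0 ≤ W₁ := Finset.sum_nonneg fun L hL => hμ₁0 L (Finset.mem_powerset.mp hL)
  have hW₂0 : 0 ≤ W₂ := Finset.sum_nonneg fun L hL => hμ₂0 L (Finset.mem_powerset.mp hL)
  have hΩ0 : 0 ≤ Ω := Finset.sum_nonneg fun L hL => hμω0 L (Finset.mem_powerset.mp hL)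
  have hWw0 : 0 ≤ Ww := Finset.sum_nonneg fun L hL => hμw0 L (Finset.mem_powerset.mp hL)
  -- `Λ = W₁ + Ww`, `Fa = Mx₁ + Mxw`, `Fb = My₁ + Myw`
  have eΛ : Λ = W₁ + Ww := by
    rw [hΛ, hLam, hW₁, hWw, pw, pw, ← Finset.sum_add_distrib]
    rfl
  have eFa : Fa = Mx₁ + Mxw := by
    rw [hFa, hMass, hMx₁, hMxw, pm, pm, ← Finset.sum_add_distrib]
    refine Finset.sum_congr rfl fun L hL => ?_
    have h1 := (hFpos L (Finset.mem_powerset.mp hL)).ne'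
    have h2 := (hFw L (Finset.mem_powerset.mp hL)).ne'
    simp only [hμ₁, hμw, wA, wB, hx₁, hxw]
    field_simp
  have eFb : Fb = My₁ + Myw := by
    rw [hFb, hMass, hMy₁, hMyw, pm, pm, ← Finset.sum_add_distrib]
    refine Finset.sum_congr rfl fun L hL => ?_
    have h1 := (hFpos L (Finset.mem_powerset.mp hL)).ne'
    have h2 := (hFw L (Finset.mem_powerset.mp hL)).ne'
    simp only [hμ₁, hμw, wA, wB, hy₁, hyw]
    field_simp
  -- FKG
  have hK₁0 : 0 ≤ K₁ := by
    have := fkg_powerset Vs μ₁ x₁ y₁ hμ₁0 hx₁0 hy₁0 hx₁m hy₁m hμ₁lsm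
    rw [hK₁, pk, sub_nonneg]; exact this
  have hK₂0 : 0 ≤ K₂ := by
    have := fkg_powerset Vs μ₂ x₂ y₂ hμ₂0 hx₂0 hy₂0 hx₂m hy₂m hμ₂lsm
    rw [hK₂, pk, sub_nonneg]; exact this
  have hKω0 : 0 ≤ Kω := by
    have := fkg_powerset Vs μω x₂ y₂ hμω0 hx₂0 hy₂0 hx₂m hy₂m hμωlsm
    rw [hKω, pk, sub_nonneg]; exact this
  -- (F1): `Mx₁ · Ww ≤ Mxw · W₁`
  have hdom₁w : ∀ L L', L ⊆ Vs → L' ⊆ Vs → μ₁ L * μw L' ≤ μ₁ (L ∩ L') * μw (L ∪ L') :=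
    fun L L' hL hL' => dom_wA_wB hw hF0 hFlsm hβ0 hβ hq0 hq1 hL hL'
  have hF1x : Mx₁ * Ww ≤ Mxw * W₁ := by
    have h := holley_powerset Vs μ₁ μw x₁ hμ₁0 hμw0 hx₁0 hx₁m hdom₁w
    have h2 : pm Vs μw x₁ ≤ Mxw := Finset.sum_le_sum fun L hL =>
      mul_le_mul_of_nonneg_left (hx₁w L (Finset.mem_powerset.mp hL))
        (hμw0 L (Finset.mem_powerset.mp hL))
    calc Mx₁ * Ww ≤ W₁ * pm Vs μw x₁ := h
      _ ≤ W₁ * Mxw := mul_le_mul_of_nonneg_left h2 hW₁0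
      _ = Mxw * W₁ := mul_comm _ _
  have hF1y : My₁ * Ww ≤ Myw * W₁ := by
    have h := holley_powerset Vs μ₁ μw y₁ hμ₁0 hμw0 hy₁0 hy₁m hdom₁w
    have h2 : pm Vs μw y₁ ≤ Myw := Finset.sum_le_sum fun L hL =>
      mul_le_mul_of_nonneg_left (hy₁w L (Finset.mem_powerset.mp hL))
        (hμw0 L (Finset.mem_powerset.mp hL))
    calc My₁ * Ww ≤ W₁ * pm Vs μw y₁ := h
      _ ≤ W₁ * Myw := mul_le_mul_of_nonneg_left h2 hW₁0
      _ = Myw * W₁ := mul_comm _ _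
  -- (F2): `Mx₁ · W₂ ≤ Mx₂ · W₁`
  have hdom₁₂ : ∀ L L', L ⊆ Vs → L' ⊆ Vs → μ₁ L * μ₂ L' ≤ μ₁ (L ∩ L') * μ₂ (L ∪ L') :=
    fun L L' hL hL' => dom_wA_wA' hw hu hF0 hFlsm hβ0 hβ hq0 hL hL'
  have hF2x : Mx₁ * W₂ ≤ Mx₂ * W₁ := by
    have h := holley_powerset Vs μ₁ μ₂ x₁ hμ₁0 hμ₂0 hx₁0 hx₁m hdom₁₂
    have h2 : pm Vs μ₂ x₁ ≤ Mx₂ := Finset.sum_le_sum fun L hL =>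
      mul_le_mul_of_nonneg_left (hx₁₂ L (Finset.mem_powerset.mp hL))
        (hμ₂0 L (Finset.mem_powerset.mp hL))
    calc Mx₁ * W₂ ≤ W₁ * pm Vs μ₂ x₁ := h
      _ ≤ W₁ * Mx₂ := mul_le_mul_of_nonneg_left h2 hW₁0
      _ = Mx₂ * W₁ := mul_comm _ _
  have hF2y : My₁ * W₂ ≤ My₂ * W₁ := by
    have h := holley_powerset Vs μ₁ μ₂ y₁ hμ₁0 hμ₂0 hy₁0 hy₁m hdom₁₂
    have h2 : pm Vs μ₂ y₁ ≤ My₂ := Finset.sum_le_sum fun L hL =>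
      mul_le_mul_of_nonneg_left (hy₁₂ L (Finset.mem_powerset.mp hL))
        (hμ₂0 L (Finset.mem_powerset.mp hL))
    calc My₁ * W₂ ≤ W₁ * pm Vs μ₂ y₁ := h
      _ ≤ W₁ * My₂ := mul_le_mul_of_nonneg_left h2 hW₁0
      _ = My₂ * W₁ := mul_comm _ _
  -- (F3): `Mx₂ · Ω ≤ Mxω · W₂`
  have hdom₂ω : ∀ L L', L ⊆ Vs → L' ⊆ Vs → μ₂ L * μω L' ≤ μ₂ (L ∩ L') * μω (L ∪ L') :=
    fun L L' hL hL' => dom_wA'_wΩ hF0 hFlsm hβ0 hβ hq0 hq1 hL hL'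
  have hF3x : Mx₂ * Ω ≤ Mxω * W₂ := by
    have h := holley_powerset Vs μ₂ μω x₂ hμ₂0 hμω0 hx₂0 hx₂m hdom₂ω
    calc Mx₂ * Ω ≤ W₂ * Mxω := h
      _ = Mxω * W₂ := mul_comm _ _
  have hF3y : My₂ * Ω ≤ Myω * W₂ := by
    have h := holley_powerset Vs μ₂ μω y₂ hμ₂0 hμω0 hy₂0 hy₂m hdom₂ω
    calc My₂ * Ω ≤ W₂ * Myω := h
      _ = Myω * W₂ := mul_comm _ _
  -- (F4): `W₂ ≤ W₁`, `W₂ ≤ Ω`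
  have hF4a : W₂ ≤ W₁ := Finset.sum_le_sum fun L hL => by
    simp only [hμ₂, hμ₁, wA', wA]
    exact mul_le_mul_of_nonneg_left
      (hFdec _ _ ((Finset.subset_insert w L).trans (Finset.subset_insert u _)))
      (hA_nonneg hβ0 hq0 (Finset.mem_powerset.mp hL))
  have hF4b : W₂ ≤ Ω := Finset.sum_le_sum fun L hL => by
    simp only [hμ₂, hμω, wA', wΩ]
    exact mul_le_mul_of_nonneg_right (hA_le_β hβ0 hq0 hq1 (Finset.mem_powerset.mp hL)) (hF0 _)
  -- (F5): the tilt lemma, `K₂ · Ω ≤ Kω · W₂`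
  have hF5 : K₂ * Ω ≤ Kω * W₂ := by
    have h := tilt_prod Vs μω x₂ y₂ q hq0 hq1 hμω0 hμωlsm hx₂0 hy₂0 hx₂m hy₂m Vs (subset_refl _)
    have e : ∀ L ⊆ Vs, tiltProd Vs q μω L = μ₂ L := fun L hL => by
      simp only [tiltProd, hμω, hμ₂, wΩ, wA', hA]
      rw [armProd_eq_tilt_factor q hL]; ring
    rwa [pk_congr e, pw_congr e] at h
  -- (LA): `Fa · Ω ≤ Mxω · Λ`
  have hmix : ∀ L L', L ⊆ Vs → L' ⊆ Vs →
      (μ₁ L + μw L) * μω L' ≤ (μ₁ (L ∩ L') + μw (L ∩ L')) * μω (L ∪ L') :=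
    fun L L' hL hL' => dom_mix_wΩ hw hu hwu hF0 hFdec hFlsm hβ0 hβ hq0 hq1 hL hL'
  have hLAx : Fa * Ω ≤ Mxω * Λ := by
    have h := holley_powerset Vs (fun L => μ₁ L + μw L) μω x₂
      (fun L hL => add_nonneg (hμ₁0 L hL) (hμw0 L hL)) hμω0 hx₂0 hx₂m hmix
    have e1 : pw Vs (fun L => μ₁ L + μw L) = Λ := by
      rw [eΛ, hW₁, hWw, pw, pw, pw, Finset.sum_add_distrib]
    have e2 : Fa ≤ pm Vs (fun L => μ₁ L + μw L) x₂ := by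
      rw [eFa, hMx₁, hMxw, pm, pm, pm, ← Finset.sum_add_distrib]
      refine Finset.sum_le_sum fun L hL => ?_
      have hL := Finset.mem_powerset.mp hL
      have h1 := mul_le_mul_of_nonneg_left (hx₁₂ L hL) (hμ₁0 L hL)
      have h2 := mul_le_mul_of_nonneg_left (hxw₂ L hL) (hμw0 L hL)
      linarith
    calc Fa * Ω ≤ pm Vs (fun L => μ₁ L + μw L) x₂ * Ω := mul_le_mul_of_nonneg_right e2 hΩ0
      _ ≤ pw Vs (fun L => μ₁ L + μw L) * Mxω := h
      _ = Mxω * Λ := by rw [e1, mul_comm]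
  have hLAy : Fb * Ω ≤ Myω * Λ := by
    have h := holley_powerset Vs (fun L => μ₁ L + μw L) μω y₂
      (fun L hL => add_nonneg (hμ₁0 L hL) (hμw0 L hL)) hμω0 hy₂0 hy₂m hmix
    have e1 : pw Vs (fun L => μ₁ L + μw L) = Λ := by
      rw [eΛ, hW₁, hWw, pw, pw, pw, Finset.sum_add_distrib]
    have e2 : Fb ≤ pm Vs (fun L => μ₁ L + μw L) y₂ := by
      rw [eFb, hMy₁, hMyw, pm, pm, pm, ← Finset.sum_add_distrib]
      refine Finset.sum_le_sum fun L hL => ?_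
      have hL := Finset.mem_powerset.mp hL
      have h1 := mul_le_mul_of_nonneg_left (hy₁₂ L hL) (hμ₁0 L hL)
      have h2 := mul_le_mul_of_nonneg_left (hyw₂ L hL) (hμw0 L hL)
      linarith
    calc Fb * Ω ≤ pm Vs (fun L => μ₁ L + μw L) y₂ * Ω := mul_le_mul_of_nonneg_right e2 hΩ0
      _ ≤ pw Vs (fun L => μ₁ L + μw L) * Myω := h
      _ = Myω * Λ := by rw [e1, mul_comm]
  -- the cleared identities
  have id₁ := shift_sum_identity Vs μ₁ x₁ y₁ Λ Fa Fb
  have id₂ := shift_sum_identity Vs μ₂ x₂ y₂ Λ Fa Fb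
  have idω := shift_sum_identity Vs μω x₂ y₂ Λ Fa Fb
  rw [← hSh₁, ← hW₁, ← hMx₁, ← hMy₁, ← hK₁] at id₁
  rw [← hSh₂, ← hW₂, ← hMx₂, ← hMy₂, ← hK₂] at id₂
  rw [← hShω, ← hΩ, ← hMxω, ← hMyω, ← hKω] at idω
  -- the degenerate cases, prepared while the sums are still visible
  have hdegW₂ : W₂ = 0 → Sh₁ = 0 ∧ Sh₂ = 0 := by
    intro hW₂zero
    have hkA : ∀ L ⊆ Vs, hA β q L = 0 := by
      intro L hL
      have h := (Finset.sum_eq_zero_iff_of_nonneg fun L hL =>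
        hμ₂0 L (Finset.mem_powerset.mp hL)).mp hW₂zero L (Finset.mem_powerset.mpr hL)
      simp only [hμ₂, wA'] at h
      exact (mul_eq_zero.mp h).resolve_right (hFposwu L hL).ne'
    exact ⟨Finset.sum_eq_zero fun L hL => by simp [hμ₁, wA, hkA L (Finset.mem_powerset.mp hL)],
      Finset.sum_eq_zero fun L hL => by simp [hμ₂, wA', hkA L (Finset.mem_powerset.mp hL)]⟩
  have hdegΩ : Ω = 0 → Sh₁ = 0 ∧ Sh₂ = 0 ∧ Shω = 0 := by
    intro hΩzero
    have hleaf : ∀ L ⊆ Vs, β L = 0 := by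
      intro L hL
      have h := (Finset.sum_eq_zero_iff_of_nonneg fun L hL =>
        hμω0 L (Finset.mem_powerset.mp hL)).mp hΩzero L (Finset.mem_powerset.mpr hL)
      simp only [hμω, wΩ] at h
      exact (mul_eq_zero.mp h).resolve_right (hFposwu L hL).ne'
    exact ⟨Finset.sum_eq_zero fun L hL => by simp [hμ₁, wA, hA, hleaf L (Finset.mem_powerset.mp hL)],
      Finset.sum_eq_zero fun L hL => by simp [hμ₂, wA', hA, hleaf L (Finset.mem_powerset.mp hL)],
      Finset.sum_eq_zero fun L hL => by simp [hμω, wΩ, hleaf L (Finset.mem_powerset.mp hL)]⟩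
  -- from here on only real arithmetic: forget the definitions
  clear_value Sh₁ Sh₂ Shω K₁ K₂ Kω Mx₁ My₁ Mx₂ My₂ Mxω Myω Mxw Myw W₁ W₂ Ω Ww Λ Fa Fb
  clear hSh₁ hSh₂ hShω hK₁ hK₂ hKω hMx₁ hMy₁ hMx₂ hMy₂ hMxω hMyω hMxw hMyw hW₁ hW₂ hΩ hWw hΛ
    hFa hFb hmix hdom₂ω hdom₁₂ hdom₁w hμ₁lsm hμ₂lsm hμωlsm hx₁m hy₁m hx₂m hy₂m hx₁₂ hy₁₂ hx₁w
    hy₁w hxw₂ hyw₂ hx₁0 hy₁0 hx₂0 hy₂0 hμ₁0 hμ₂0 hμω0 hμw0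
  rcases hΩ0.lt_or_eq with hΩpos | hΩzero
  · rcases hW₂0.lt_or_eq with hW₂pos | hW₂zero
    · -- the main case: all masses positive
      have hW₁pos : 0 < W₁ := lt_of_lt_of_le hW₂pos hF4a
      have hΛpos : 0 < Λ := by rw [eΛ]; linarith
      have hm₁ : Mx₁ * Λ ≤ Fa * W₁ := by rw [eΛ, eFa]; nlinarith [hF1x]
      have hn₁ : My₁ * Λ ≤ Fb * W₁ := by rw [eΛ, eFb]; nlinarith [hF1y]
      exact kStar_main Λ Fa Fb W₁ W₂ Ω Mx₁ My₁ Mx₂ My₂ Mxω Myω K₁ K₂ Kω Sh₁ Sh₂ Shω hW₁pos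
        hW₂pos hΩpos hΛpos id₁ id₂ idω hK₁0 hF5 hF4a hF4b hm₁ hn₁ hF2x hF2y hF3x hF3y hLAx hLAy
    · -- `W₂ = 0`: `S′ = Shω ≥ 0`
      obtain ⟨h1, h2⟩ := hdegW₂ hW₂zero.symm
      have hShω0 : 0 ≤ Shω := by
        have k1 : 0 ≤ Λ * Mxω - Fa * Ω := by linarith
        have k2 : 0 ≤ Λ * Myω - Fb * Ω := by linarith
        have : 0 ≤ Ω * Shω := by
          rw [idω]; exact add_nonneg (mul_nonneg (sq_nonneg _) hKω0) (mul_nonneg k1 k2)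
        exact (mul_nonneg_iff_of_pos_left hΩpos).mp this
      rw [h1, h2]; linarith
  · -- `Ω = 0`: everything vanishes
    obtain ⟨h1, h2, h3⟩ := hdegΩ hΩzero.symm
    rw [h1, h2, h3]; simp


/-- **The abstract k-star lemma** (`S′ ≥ 0`, NIGHT2-DARC.md §26): the LSM-head lemma for the
PRODUCT leaf law `leafLaw Vs β` of independent leaves (`β i ∈ [0, 1]`). -/
theorem kStar_functional_nonneg (Vs : Finset V) (w u : V) (hw : w ∉ Vs) (hu : u ∉ Vs)
    (hwu : w ≠ u) (F Ga Gb : Finset V → R) (hF0 : ∀ S, 0 ≤ F S)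
    (hFdec : ∀ S S', S ⊆ S' → F S' ≤ F S)
    (hFlsm : ∀ S S', F S * F S' ≤ F (S ∩ S') * F (S ∪ S'))
    (hFpos : ∀ L ⊆ Vs, 0 < F L) (hFposwu : ∀ L ⊆ Vs, 0 < F (insert u (insert w L)))
    (hGa0 : ∀ S, 0 ≤ Ga S) (hGb0 : ∀ S, 0 ≤ Gb S)
    (hGa : ∀ S S', S ⊆ S' → Ga S * F S' ≤ Ga S' * F S)
    (hGb : ∀ S S', S ⊆ S' → Gb S * F S' ≤ Gb S' * F S)
    (β q : V → R) (hβ0 : ∀ i ∈ Vs, 0 ≤ β i) (hβ1 : ∀ i ∈ Vs, β i ≤ 1)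
    (hq0 : ∀ i ∈ Vs, 0 ≤ q i) (hq1 : ∀ i ∈ Vs, q i ≤ 1) :
    0 ≤ (∑ L ∈ Vs.powerset, kA Vs β q L * F L *
          (Ga L / F L * kLam Vs β q w F - kMass Vs β q w Ga) *
          (Gb L / F L * kLam Vs β q w F - kMass Vs β q w Gb)) +
        ∑ L ∈ Vs.powerset, kB Vs β q L * F (insert u (insert w L)) *
          (Ga (insert u (insert w L)) / F (insert u (insert w L)) * kLam Vs β q w F -
            kMass Vs β q w Ga) *
          (Gb (insert u (insert w L)) / F (insert u (insert w L)) * kLam Vs β q w F -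
            kMass Vs β q w Gb) := by
  rw [kA_eq_hA, kB_eq_hB, kLam_eq_hLam, kMass_eq_hMass, kMass_eq_hMass]
  exact lsmHead_functional_nonneg Vs w u hw hu hwu F Ga Gb hF0 hFdec hFlsm hFpos hFposwu hGa0
    hGb0 hGa hGb (leafLaw Vs β) (fun L _ => leafLaw_nonneg hβ0 hβ1 L)
    (fun L L' _ _ => (leafLaw_mul Vs β L L').le) q hq0 hq1

end KStarAbstract

end Summit.Ventures.PercRepro2.Coin
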